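import Summits.QuantumFields.YangMills.Theorems.SwapVirialDeficitSectorLaplaceTipPXMain
import HarnessLib

/-!
# Route `SwapVirialDeficit` (YangMills): THE PY LEADER INTEGRAL OF THE ALIGNED FRAME AGAINST THE PROFILE (hCore F5c′, region PY = swap twin of PX)
# (cell ym-idea-1, skeleton ➎, `stub_core_tip`, the core; free-hands support of ⟨stmt-QuantumFields-24197⟩ `SwapVirialDeficit.SwapGluedStiffness`)

Pure analysis.  ★★ `lintegral_PY_main_le` — ✓`lintegral_PX_main_le` transported by the swap `(x,y) ↦ (y,x)` of the leader pair (Mathlib `lintegral_prod_swap`;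
`Cross` and `x·y` are symmetric by `ring`) with the reference factor `D′(a,b) = D(b,a)`, followed by the swap `p ↦ (p₂,p₁)` of the base plane (the profile and the
weight `w₀` are symmetric): on `PY = {|x|² < |y|², σ < |y|²}`,
`∫⁻_{PY} w(y)e^{−β₁2σ|y⊥|²∕(1+|y|²)}·w(x)e^{−β₃Cross(x,y)}·D(x·y∕√|y|², √|y|²) ≤ ofReal((3π+48)π²∕(β₁β₃))·∫⁻_p Profile(δt,p)·w₀(p)·D(p)`.

HONEST LABEL: one analytic brick; `leaderLayer_PY`, ORIG, the merge instance, hence hCore ∕ `stub_core_tip` ∕ ⟨24197⟩ ∕ ⟨24194⟩ remain OPEN; own crux ⟨22884⟩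
`LargeFieldMassRefinementTail` OPEN (blocked-on ⟨19935⟩); the Yang–Mills mass gap is NOT proved; no summit is proved by a line.
THEOREMS ONLY (0 `def`, 0 `sorry`, no instance), standard axioms.  Width seat ym-line-sfw-p2-w2 g61 (cell ym-idea-1, free hands), `--supports stmt-QuantumFields-24197`.
References: [folklore].
-/

set_option autoImplicit false

noncomputable section

open MeasureTheory Set
open scoped BigOperators ENNReal

namespace Summit.QuantumFields.YangMills.Theorems.SwapVirialDeficit.SectorLaplace

open Summit.QuantumFields.YangMills.Theorems.SwapVirialDeficit.BlowUpRing
open Summit.QuantumFields.YangMills.Theorems.SwapVirialDeficit.Gnomonic (normSq3 normSq3_nonneg gnomonicWeight gnomonicWeight_pos)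

set_option maxHeartbeats 1600000 in
/-- ★★ **THE PY LEADER INTEGRAL AGAINST THE PROFILE** (swap twin of ✓`lintegral_PX_main_le`; see the file header). [folklore] -/
theorem lintegral_PY_main_le {δt β₁ β₃ : ℝ} (hδt : 1 ≤ δt) (hβ₁ : 0 < β₁) (hβ₃ : 0 < β₃) {D : ℝ × ℝ → ℝ≥0∞} (hD : Measurable D) :
    ∫⁻ xy in {xy : (Fin 3 → ℝ) × (Fin 3 → ℝ) | normSq3 xy.1 < normSq3 xy.2 ∧ (1 + δt ^ 2)⁻¹ < normSq3 xy.2},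
        ENNReal.ofReal (gnomonicWeight xy.2 * Real.exp (-(β₁ * (2 * (1 + δt ^ 2)⁻¹ * (xy.2 1 ^ 2 + xy.2 2 ^ 2) / (1 + normSq3 xy.2))))) *
        (ENNReal.ofReal (gnomonicWeight xy.1 * Real.exp (-(β₃ * (4 * ((xy.1 1 * xy.2 2 - xy.1 2 * xy.2 1) ^ 2 + (xy.1 2 * xy.2 0 - xy.1 0 * xy.2 2) ^ 2 +
            (xy.1 0 * xy.2 1 - xy.1 1 * xy.2 0) ^ 2) / ((1 + normSq3 xy.1) * (1 + normSq3 xy.2)))))) *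
          D ((Real.sqrt (normSq3 xy.2))⁻¹ * (xy.1 0 * xy.2 0 + xy.1 1 * xy.2 1 + xy.1 2 * xy.2 2), Real.sqrt (normSq3 xy.2))) ≤
      ENNReal.ofReal ((3 * Real.pi + 48) * Real.pi ^ 2 / (β₁ * β₃)) *
        ∫⁻ p : ℝ × ℝ, ENNReal.ofReal ((1 + δt ^ 2) ^ 2 / (1 + (p.1 ^ 2 / (1 + p.1 ^ 2) + p.2 ^ 2 / (1 + p.2 ^ 2)) * (1 + δt ^ 2)) *
          ((1 + p.1 ^ 2)⁻¹ * (1 + p.2 ^ 2)⁻¹)) * D p := by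
  set σ : ℝ := (1 + δt ^ 2)⁻¹ with hσdef
  have hmeasN : Measurable (normSq3 : (Fin 3 → ℝ) → ℝ) := continuous_normSq3.measurable
  -- the swapped reference factor
  set D' : ℝ × ℝ → ℝ≥0∞ := fun q => D (q.2, q.1) with hD'
  have hD'm : Measurable D' := hD.comp (measurable_snd.prodMk measurable_fst)
  -- the PY integrand and the PX integrand (for `D'`)
  set G : (Fin 3 → ℝ) × (Fin 3 → ℝ) → ℝ≥0∞ := fun xy =>
    ENNReal.ofReal (gnomonicWeight xy.2 * Real.exp (-(β₁ * (2 * σ * (xy.2 1 ^ 2 + xy.2 2 ^ 2) / (1 + normSq3 xy.2))))) *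
      (ENNReal.ofReal (gnomonicWeight xy.1 * Real.exp (-(β₃ * (4 * ((xy.1 1 * xy.2 2 - xy.1 2 * xy.2 1) ^ 2 + (xy.1 2 * xy.2 0 - xy.1 0 * xy.2 2) ^ 2 +
          (xy.1 0 * xy.2 1 - xy.1 1 * xy.2 0) ^ 2) / ((1 + normSq3 xy.1) * (1 + normSq3 xy.2)))))) *
        D ((Real.sqrt (normSq3 xy.2))⁻¹ * (xy.1 0 * xy.2 0 + xy.1 1 * xy.2 1 + xy.1 2 * xy.2 2), Real.sqrt (normSq3 xy.2))) with hG
  set P : (Fin 3 → ℝ) × (Fin 3 → ℝ) → ℝ≥0∞ := fun xy =>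
    ENNReal.ofReal (gnomonicWeight xy.1 * Real.exp (-(β₁ * (2 * σ * (xy.1 1 ^ 2 + xy.1 2 ^ 2) / (1 + normSq3 xy.1))))) *
      (ENNReal.ofReal (gnomonicWeight xy.2 * Real.exp (-(β₃ * (4 * ((xy.1 1 * xy.2 2 - xy.1 2 * xy.2 1) ^ 2 + (xy.1 2 * xy.2 0 - xy.1 0 * xy.2 2) ^ 2 +
          (xy.1 0 * xy.2 1 - xy.1 1 * xy.2 0) ^ 2) / ((1 + normSq3 xy.1) * (1 + normSq3 xy.2)))))) *
        D' (Real.sqrt (normSq3 xy.1), (Real.sqrt (normSq3 xy.1))⁻¹ * (xy.1 0 * xy.2 0 + xy.1 1 * xy.2 1 + xy.1 2 * xy.2 2))) with hP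
  have hswapG : ∀ z : (Fin 3 → ℝ) × (Fin 3 → ℝ), G z.swap = P z := by
    intro z
    rw [hG, hP, hD']
    simp only [Prod.fst_swap, Prod.snd_swap]
    have e1 : (z.2 1 * z.1 2 - z.2 2 * z.1 1) ^ 2 + (z.2 2 * z.1 0 - z.2 0 * z.1 2) ^ 2 + (z.2 0 * z.1 1 - z.2 1 * z.1 0) ^ 2 =
        (z.1 1 * z.2 2 - z.1 2 * z.2 1) ^ 2 + (z.1 2 * z.2 0 - z.1 0 * z.2 2) ^ 2 + (z.1 0 * z.2 1 - z.1 1 * z.2 0) ^ 2 := by ring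
    have e2 : (1 + normSq3 z.2) * (1 + normSq3 z.1) = (1 + normSq3 z.1) * (1 + normSq3 z.2) := mul_comm _ _
    have e3 : z.2 0 * z.1 0 + z.2 1 * z.1 1 + z.2 2 * z.1 2 = z.1 0 * z.2 0 + z.1 1 * z.2 1 + z.1 2 * z.2 2 := by ring
    rw [e1, e2, e3]
  -- the regions
  set S : Set ((Fin 3 → ℝ) × (Fin 3 → ℝ)) := {xy | normSq3 xy.1 < normSq3 xy.2 ∧ σ < normSq3 xy.2} with hSdef
  set S' : Set ((Fin 3 → ℝ) × (Fin 3 → ℝ)) := {xy | normSq3 xy.1 ≤ normSq3 xy.2 ∧ σ < normSq3 xy.2} with hS'def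
  set T : Set ((Fin 3 → ℝ) × (Fin 3 → ℝ)) := {xy | normSq3 xy.2 ≤ normSq3 xy.1 ∧ σ < normSq3 xy.1} with hTdef
  have hS' : MeasurableSet S' := by
    rw [hS'def]
    exact (measurableSet_le (hmeasN.comp measurable_fst) (hmeasN.comp measurable_snd)).inter (measurableSet_lt measurable_const (hmeasN.comp measurable_snd))
  have hT : MeasurableSet T := by
    rw [hTdef]
    exact (measurableSet_le (hmeasN.comp measurable_snd) (hmeasN.comp measurable_fst)).inter (measurableSet_lt measurable_const (hmeasN.comp measurable_fst))
  have hSS' : S ⊆ S' := fun xy h => ⟨h.1.le, h.2⟩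
  -- step 1: enlarge `S` to `S'`, step 2: swap to the PX region `T`
  have h1 : ∫⁻ xy in S, G xy ≤ ∫⁻ xy in S', G xy := lintegral_mono_set hSS'
  have h2 : ∫⁻ xy in S', G xy = ∫⁻ z in T, P z := by
    rw [← lintegral_indicator hS', ← lintegral_indicator hT,
      show (volume : Measure ((Fin 3 → ℝ) × (Fin 3 → ℝ))) = (volume : Measure (Fin 3 → ℝ)).prod volume from rfl,
      ← lintegral_prod_swap]
    refine lintegral_congr fun z => ?_
    by_cases hz : z ∈ T
    · have hz' : z.swap ∈ S' := by rw [hTdef] at hz; rw [hS'def]; exact ⟨hz.1, hz.2⟩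
      rw [Set.indicator_of_mem hz', Set.indicator_of_mem hz, hswapG]
    · have hz' : z.swap ∉ S' := by rw [hTdef] at hz; rw [hS'def]; exact fun h => hz ⟨h.1, h.2⟩
      rw [Set.indicator_of_notMem hz', Set.indicator_of_notMem hz]
  -- step 3: the PX lemma for `D'`
  have h3 : ∫⁻ z in T, P z ≤ ENNReal.ofReal ((3 * Real.pi + 48) * Real.pi ^ 2 / (β₁ * β₃)) *
      ∫⁻ p : ℝ × ℝ, ENNReal.ofReal ((1 + δt ^ 2) ^ 2 / (1 + (p.1 ^ 2 / (1 + p.1 ^ 2) + p.2 ^ 2 / (1 + p.2 ^ 2)) * (1 + δt ^ 2)) *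
        ((1 + p.1 ^ 2)⁻¹ * (1 + p.2 ^ 2)⁻¹)) * D' p := lintegral_PX_main_le hδt hβ₁ hβ₃ hD'm
  -- step 4: swap the base plane back
  have h4 : ∫⁻ p : ℝ × ℝ, ENNReal.ofReal ((1 + δt ^ 2) ^ 2 / (1 + (p.1 ^ 2 / (1 + p.1 ^ 2) + p.2 ^ 2 / (1 + p.2 ^ 2)) * (1 + δt ^ 2)) *
        ((1 + p.1 ^ 2)⁻¹ * (1 + p.2 ^ 2)⁻¹)) * D' p =
      ∫⁻ p : ℝ × ℝ, ENNReal.ofReal ((1 + δt ^ 2) ^ 2 / (1 + (p.1 ^ 2 / (1 + p.1 ^ 2) + p.2 ^ 2 / (1 + p.2 ^ 2)) * (1 + δt ^ 2)) *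
        ((1 + p.1 ^ 2)⁻¹ * (1 + p.2 ^ 2)⁻¹)) * D p := by
    rw [show (volume : Measure (ℝ × ℝ)) = (volume : Measure ℝ).prod volume from rfl, ← lintegral_prod_swap]
    refine lintegral_congr fun p => ?_
    rw [hD']
    simp only [Prod.fst_swap, Prod.snd_swap]
    rw [add_comm (p.2 ^ 2 / (1 + p.2 ^ 2)), mul_comm ((1 + p.2 ^ 2)⁻¹)]
  calc ∫⁻ xy in S, G xy ≤ ∫⁻ xy in S', G xy := h1
    _ = ∫⁻ z in T, P z := h2
    _ ≤ _ := h3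
    _ = _ := by rw [h4]

end Summit.QuantumFields.YangMills.Theorems.SwapVirialDeficit.SectorLaplace

end
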